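import Mathlib
import HarnessLib

/-!
# Connectivity correlation inequalities for `φ_{w,q}`, every `q > 0` — the 2×2 TRANSFER-MATRIX CORE of the wheel theorems
# (negative correlation of any two spokes / any two rim edges of an apex-over-cycles graph, `0 < q ≤ 1`)

Support file (`--supports stmt-CriticalPhenomena-4575`), FK sub-lane `prim-bschramm-fk-3` (gen 8) of the post-continuity programme; builds on
p205010 (kernel theorem, internal audit signed; external expert review pending).  Pure real 2×2 algebra: no measure theory, no named facts, no
sorries; standard axioms.  Blueprint and paper proofs: bschramm/prim-bschramm-fk-3/WHEELS-HUB-NC.md (THEOREMS W, W′), FK-BARRIER.md §12.3–12.5.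

THE THEOREMS SERVED (paper-proved there, every identity machine-checked on exact instances): let `x` be a vertex of a finite graph `G` such that
`G − x` has maximum degree `≤ 2` (e.g. every wheel `W_n` with hub `x`, any subset of spokes, every fan).  Then for all edge parameters in `[0,1]` and
all `0 < q ≤ 1`, under the random-cluster measure `φ_{G,w,q}` (Grimmett 2006 (1.20)): (W) any two edges at `x` are negatively correlated; (W′) any
two edges of `G − x` are negatively correlated.  For wheels this is every spoke pair and every rim pair (the non-consecutive ones are DISJOINT pairs,
outside Wagner's two-sum class — Wagner 2008 §5.3, Grimmett 2006 §3.9).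
THE REDUCTION (LEMMA T of the memo, NOT formalised in this file): reading the rim cycle with the 2×2 matrices `spokeM p = [[1,p],[0,1−p]]` (an open spoke
forces the state 'current arc attached') and `edgeM q r = [[r,0],[1−r, r+(1−r)q]]` (a closed rim edge closes the arc, emitting `1` or `q`),
`Z_{G,w,q} = q·[Tr ∏ (edgeM·spokeM) − (2−q)·∏ r_i·∏ (1−p_v)]`, and negative correlation of the two marked elements is EXACTLY the nonnegativity of
`D_SS` (two spokes), resp. `D_EE` (two rim edges), below, where `A`, `B` are the transfer products of the two rim stretches between the marked elements and
`ρ_A, ρ_B` the products of their `r_i` and `1 − p_v`.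
THIS FILE proves that nonnegativity for every pair of matrices carrying the INVARIANTS `FK.WheelTM.RimInv q ρ M` (entries and determinant `≥ 0`; monotone
covectors `f_yes ≥ f_no ≥ 0` and `f_no ≥ q f_yes ≥ 0` are preserved; `κ = M₁₁−M₁₀ ≤ ρ ≤ χ = M₁₁ − qM₁₀`; `μ = qM₀₀ − M₀₁ ≤ qρ`), and that the invariants hold
for the identity and are preserved under left multiplication by `spokeM p` (`ρ ↦ (1−p)ρ`) and `edgeM q r` (`ρ ↦ rρ`), `p, r ∈ [0,1]`, `0 ≤ q ≤ 1` — hence for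
every rim stretch.  Main results: `RimInv.one`, `RimInv.spoke_mul`, `RimInv.edge_mul`, the generic KEY IDENTITIES `key_identity_SS/EE`, and
**`dSS_nonneg`**, **`dEE_nonneg`** (with the trace forms `wheelHub_trace_form_nonneg`, `wheelRim_trace_form_nonneg`).
[cite: Grimmett2006, §1.4 eq. (1.20) (p. 15); §3.9 eq. (3.94), Conj. (3.96) (pp. 63–66)] [cite: Wagner2006, Thm. 5.8, §5.3 (pp. 14–15)]
-/

noncomputable section

namespace Summit.CriticalPhenomena.PercolationContinuityZ3.Theorems

namespace FK

namespace WheelTM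

open Matrix

/-- The spoke transfer matrix `[[1, p], [0, 1 − p]]` (index `0` = 'arc attached', `1` = 'not yet'): an open spoke (probability `p`) forces
'attached'. [cite: Grimmett2006, §1.4 eq. (1.20) (p. 15)] -/
def spokeM (p : ℝ) : Matrix (Fin 2) (Fin 2) ℝ := !![1, p; 0, 1 - p]

/-- The rim-edge transfer matrix `[[r, 0], [1 − r, r + (1 − r) q]]`: an open rim edge (probability `r`) keeps the state, a closed one closes the current
arc — factor `1` if attached, `q` if not — and restarts in 'not yet'. [cite: Grimmett2006, §1.4 eq. (1.20) (p. 15)] -/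
def edgeM (q r : ℝ) : Matrix (Fin 2) (Fin 2) ℝ := !![r, 0; 1 - r, r + (1 - r) * q]

/-- Entry `(0,0)` of the spoke matrix. [folklore] -/
@[simp] theorem spokeM_00 (p : ℝ) : spokeM p 0 0 = 1 := rfl
/-- Entry `(0,1)` of the spoke matrix. [folklore] -/
@[simp] theorem spokeM_01 (p : ℝ) : spokeM p 0 1 = p := rfl
/-- Entry `(1,0)` of the spoke matrix. [folklore] -/
@[simp] theorem spokeM_10 (p : ℝ) : spokeM p 1 0 = 0 := rfl
/-- Entry `(1,1)` of the spoke matrix. [folklore] -/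
@[simp] theorem spokeM_11 (p : ℝ) : spokeM p 1 1 = 1 - p := rfl
/-- Entry `(0,0)` of the rim-edge matrix. [folklore] -/
@[simp] theorem edgeM_00 (q r : ℝ) : edgeM q r 0 0 = r := rfl
/-- Entry `(0,1)` of the rim-edge matrix. [folklore] -/
@[simp] theorem edgeM_01 (q r : ℝ) : edgeM q r 0 1 = 0 := rfl
/-- Entry `(1,0)` of the rim-edge matrix. [folklore] -/
@[simp] theorem edgeM_10 (q r : ℝ) : edgeM q r 1 0 = 1 - r := rfl
/-- Entry `(1,1)` of the rim-edge matrix. [folklore] -/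
@[simp] theorem edgeM_11 (q r : ℝ) : edgeM q r 1 1 = r + (1 - r) * q := rfl

/-- Entries of a product with a spoke matrix on the left. [folklore] -/
theorem spokeM_mul_apply (p : ℝ) (M : Matrix (Fin 2) (Fin 2) ℝ) (j : Fin 2) :
    (spokeM p * M) 0 j = M 0 j + p * M 1 j ∧ (spokeM p * M) 1 j = (1 - p) * M 1 j := by
  constructor <;> simp [Matrix.mul_apply, Fin.sum_univ_two]

/-- Entries of a product with a rim-edge matrix on the left. [folklore] -/
theorem edgeM_mul_apply (q r : ℝ) (M : Matrix (Fin 2) (Fin 2) ℝ) (j : Fin 2) :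
    (edgeM q r * M) 0 j = r * M 0 j ∧ (edgeM q r * M) 1 j = (1 - r) * M 0 j + (r + (1 - r) * q) * M 1 j := by
  constructor <;> simp [Matrix.mul_apply, Fin.sum_univ_two]

/-- **The invariants of a rim transfer product** `M` with weight product `ρ` (= the product of the `r_i` and `1 − p_v` of the stretch), for the
cluster weight `q`: nonnegative entries and determinant; monotone covectors `f_yes ≥ f_no ≥ 0` stay monotone (`mono`); covectors with `f_no ≥ q·f_yes ≥ 0`
stay so (`monoq`); `κ = M₁₁ − M₁₀ ≤ ρ`; `χ = M₁₁ − q M₁₀ ≥ ρ`; `μ = q M₀₀ − M₀₁ ≤ q ρ`. (transcription of bschramm/prim-bschramm-fk-3/WHEELS-HUB-NC.md §4, §7) -/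
structure RimInv (q ρ : ℝ) (M : Matrix (Fin 2) (Fin 2) ℝ) : Prop where
  nonneg : ∀ i j, 0 ≤ M i j
  det_nonneg : 0 ≤ M 0 0 * M 1 1 - M 0 1 * M 1 0
  rho_nonneg : 0 ≤ ρ
  mono : ∀ f0 f1 : ℝ, 0 ≤ f1 → f1 ≤ f0 → f0 * M 0 1 + f1 * M 1 1 ≤ f0 * M 0 0 + f1 * M 1 0
  monoq : ∀ f0 f1 : ℝ, 0 ≤ f0 → q * f0 ≤ f1 → q * (f0 * M 0 0 + f1 * M 1 0) ≤ f0 * M 0 1 + f1 * M 1 1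
  kappa_le : M 1 1 - M 1 0 ≤ ρ
  chi_ge : ρ ≤ M 1 1 - q * M 1 0
  mu_le : q * M 0 0 - M 0 1 ≤ q * ρ

/-- The empty stretch: the identity matrix with `ρ = 1` carries the invariants (any `q`). (transcription of bschramm/prim-bschramm-fk-3/WHEELS-HUB-NC.md §4) -/
theorem RimInv.one (q : ℝ) : RimInv q 1 (1 : Matrix (Fin 2) (Fin 2) ℝ) := by
  refine ⟨?_, ?_, zero_le_one, ?_, ?_, ?_, ?_, ?_⟩
  · intro i j
    fin_cases i <;> fin_cases j <;> simp
  · simp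
  · intro f0 f1 h1 h01; simpa using h01
  · intro f0 f1 h0 hq; simpa using hq
  · simp
  · simp
  · simp

/-- **A spoke preserves the invariants**: `RimInv q ρ M → RimInv q ((1−p)ρ) (spokeM p * M)` for `p ∈ [0,1]`, `0 ≤ q ≤ 1`.
(transcription of bschramm/prim-bschramm-fk-3/WHEELS-HUB-NC.md §4, §7) -/
theorem RimInv.spoke_mul {q ρ p : ℝ} {M : Matrix (Fin 2) (Fin 2) ℝ} (h : RimInv q ρ M) (hq0 : 0 ≤ q) (hq1 : q ≤ 1)
    (hp0 : 0 ≤ p) (hp1 : p ≤ 1) : RimInv q ((1 - p) * ρ) (spokeM p * M) := by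
  have e0 := fun j => (spokeM_mul_apply p M j).1
  have e1 := fun j => (spokeM_mul_apply p M j).2
  have n00 := h.nonneg 0 0; have n01 := h.nonneg 0 1; have n10 := h.nonneg 1 0; have n11 := h.nonneg 1 1
  refine ⟨?_, ?_, mul_nonneg (sub_nonneg.2 hp1) h.rho_nonneg, ?_, ?_, ?_, ?_, ?_⟩
  · intro i j
    fin_cases i
    · simp only [Fin.zero_eta]; rw [e0 j]; have := h.nonneg 0 j; have := h.nonneg 1 j; positivity
    · simp only [Fin.mk_one]; rw [e1 j]; have := h.nonneg 1 j; exact mul_nonneg (sub_nonneg.2 hp1) this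
  · rw [e0 0, e0 1, e1 0, e1 1]
    have hd := h.det_nonneg
    nlinarith [mul_nonneg (sub_nonneg.2 hp1) hd]
  · -- monotone covectors: `f (S M) = (f S) M` with `f S = (f0, p f0 + (1-p) f1)`
    intro f0 f1 hf1 hf
    rw [e0 0, e0 1, e1 0, e1 1]
    have h0' : 0 ≤ p * f0 + (1 - p) * f1 := by have : 0 ≤ f0 := hf1.trans hf; positivity
    have hle : p * f0 + (1 - p) * f1 ≤ f0 := by nlinarith
    have := h.mono f0 (p * f0 + (1 - p) * f1) h0' hle
    nlinarith [this]
  · intro f0 f1 hf0 hf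
    rw [e0 0, e0 1, e1 0, e1 1]
    have hf1 : 0 ≤ f1 := (mul_nonneg hq0 hf0).trans hf
    have hle : q * f0 ≤ p * f0 + (1 - p) * f1 := by nlinarith [mul_nonneg hp0 (sub_nonneg.2 hq1), mul_nonneg hp0 hf0]
    have := h.monoq f0 (p * f0 + (1 - p) * f1) hf0 hle
    nlinarith [this]
  · rw [e1 0, e1 1]
    have := h.kappa_le
    nlinarith [mul_le_mul_of_nonneg_left this (sub_nonneg.2 hp1)]
  · rw [e1 0, e1 1]
    have := h.chi_ge
    nlinarith [mul_le_mul_of_nonneg_left this (sub_nonneg.2 hp1)]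
  · -- `μ(S M) = μ(M) − p χ(M) ≤ qρ − pρ ≤ q (1−p) ρ`
    rw [e0 0, e0 1]
    have h1 := h.mu_le; have h2 := h.chi_ge; have h3 := h.rho_nonneg
    nlinarith [mul_le_mul_of_nonneg_left h2 hp0, mul_nonneg hp0 (mul_nonneg (sub_nonneg.2 hq1) h3)]

/-- **A rim edge preserves the invariants**: `RimInv q ρ M → RimInv q (rρ) (edgeM q r * M)` for `r ∈ [0,1]`, `0 ≤ q ≤ 1`.
(transcription of bschramm/prim-bschramm-fk-3/WHEELS-HUB-NC.md §4, §7) -/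
theorem RimInv.edge_mul {q ρ r : ℝ} {M : Matrix (Fin 2) (Fin 2) ℝ} (h : RimInv q ρ M) (hq0 : 0 ≤ q) (hq1 : q ≤ 1)
    (hr0 : 0 ≤ r) (hr1 : r ≤ 1) : RimInv q (r * ρ) (edgeM q r * M) := by
  have e0 := fun j => (edgeM_mul_apply q r M j).1
  have e1 := fun j => (edgeM_mul_apply q r M j).2
  have n00 := h.nonneg 0 0; have n01 := h.nonneg 0 1; have n10 := h.nonneg 1 0; have n11 := h.nonneg 1 1
  have hm : 0 ≤ r + (1 - r) * q := by positivity
  refine ⟨?_, ?_, mul_nonneg hr0 h.rho_nonneg, ?_, ?_, ?_, ?_, ?_⟩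
  · intro i j
    fin_cases i
    · simp only [Fin.zero_eta]; rw [e0 j]; exact mul_nonneg hr0 (h.nonneg 0 j)
    · simp only [Fin.mk_one]; rw [e1 j]; have := h.nonneg 0 j; have := h.nonneg 1 j; positivity
  · rw [e0 0, e0 1, e1 0, e1 1]
    have hd := h.det_nonneg
    nlinarith [mul_nonneg (mul_nonneg hr0 hm) hd]
  · -- `f E = (r f0 + (1-r) f1, (r + (1-r) q) f1)`: still monotone and nonnegative
    intro f0 f1 hf1 hf
    rw [e0 0, e0 1, e1 0, e1 1]
    have h0' : 0 ≤ (r + (1 - r) * q) * f1 := mul_nonneg hm hf1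
    have hle : (r + (1 - r) * q) * f1 ≤ r * f0 + (1 - r) * f1 := by
      nlinarith [mul_nonneg hr0 (sub_nonneg.2 hf), mul_nonneg (mul_nonneg (sub_nonneg.2 hr1) (sub_nonneg.2 hq1)) hf1]
    have := h.mono (r * f0 + (1 - r) * f1) ((r + (1 - r) * q) * f1) h0' hle
    nlinarith [this]
  · intro f0 f1 hf0 hf
    rw [e0 0, e0 1, e1 0, e1 1]
    have hf1 : 0 ≤ f1 := (mul_nonneg hq0 hf0).trans hf
    have h0' : 0 ≤ r * f0 + (1 - r) * f1 := by positivity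
    have hle : q * (r * f0 + (1 - r) * f1) ≤ (r + (1 - r) * q) * f1 := by nlinarith [mul_nonneg hr0 (sub_nonneg.2 hf)]
    have := h.monoq (r * f0 + (1 - r) * f1) ((r + (1 - r) * q) * f1) h0' hle
    nlinarith [this]
  · -- `κ(E M) = r κ(M) − (1−r)[(cM)_yes − (cM)_no] ≤ r κ(M) ≤ r ρ`, `c = (1, q)`
    rw [e1 0, e1 1]
    have hc := h.mono 1 q hq0 hq1
    have hk := h.kappa_le
    nlinarith [mul_le_mul_of_nonneg_left hk hr0, mul_nonneg (sub_nonneg.2 hr1) (sub_nonneg.2 hc)]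
  · -- `χ(E M) = r χ(M) + (1−r) ψ(M)`, `ψ(M) = (cM)_no − q (cM)_yes ≥ 0`
    rw [e1 0, e1 1]
    have hψ := h.monoq 1 q zero_le_one (by rw [mul_one])
    have hx := h.chi_ge
    nlinarith [mul_le_mul_of_nonneg_left hx hr0, mul_nonneg (sub_nonneg.2 hr1) (sub_nonneg.2 hψ)]
  · -- `μ(E M) = r μ(M)`
    rw [e0 0, e0 1]
    have := h.mu_le
    nlinarith [mul_le_mul_of_nonneg_left this hr0]

/-! ### The generic 2×2 identities behind the two pair types -/

/-- **KEY IDENTITY, spoke–spoke**: for all 2×2 matrices `A, B`,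
`(𝟙ᵀBAe₀)(𝟙ᵀABe₀) − (𝟙ᵀAe₀)(𝟙ᵀBe₀)·Tr(AB) = det A·det B − det A·α_Bκ_B − det B·α_Aκ_A` with `α_M = M₀₀+M₁₀`, `κ_M = M₁₁ − M₁₀`.
(transcription of bschramm/prim-bschramm-fk-3/WHEELS-HUB-NC.md §3) -/
theorem key_identity_SS (a00 a01 a10 a11 b00 b01 b10 b11 : ℝ) :
    ((b00 * a00 + b01 * a10) + (b10 * a00 + b11 * a10)) * ((a00 * b00 + a01 * b10) + (a10 * b00 + a11 * b10)) -
        (a00 + a10) * (b00 + b10) * ((a00 * b00 + a01 * b10) + (a10 * b01 + a11 * b11)) =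
      (a00 * a11 - a01 * a10) * (b00 * b11 - b01 * b10) - (a00 * a11 - a01 * a10) * ((b00 + b10) * (b11 - b10)) -
        (b00 * b11 - b01 * b10) * ((a00 + a10) * (a11 - a10)) := by
  ring

/-- **KEY IDENTITY, rim–rim**: for all 2×2 matrices `A, B` and `c = (1, q)`,
`(cᵀABe₁)(cᵀBAe₁) − Tr(AB)·λ_Aλ_B = q²·det A·det B − det A·λ_Bμ_B − det B·λ_Aμ_A` with `λ_M = M₀₁ + qM₁₁`, `μ_M = qM₀₀ − M₀₁`.
(transcription of bschramm/prim-bschramm-fk-3/WHEELS-HUB-NC.md §7) -/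
theorem key_identity_EE (q a00 a01 a10 a11 b00 b01 b10 b11 : ℝ) :
    ((a00 * b01 + a01 * b11) + q * (a10 * b01 + a11 * b11)) * ((b00 * a01 + b01 * a11) + q * (b10 * a01 + b11 * a11)) -
        ((a00 * b00 + a01 * b10) + (a10 * b01 + a11 * b11)) * ((a01 + q * a11) * (b01 + q * b11)) =
      q ^ 2 * (a00 * a11 - a01 * a10) * (b00 * b11 - b01 * b10) - (a00 * a11 - a01 * a10) * ((b01 + q * b11) * (q * b00 - b01)) -
        (b00 * b11 - b01 * b10) * ((a01 + q * a11) * (q * a00 - a01)) := by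
  ring

/-! ### Positivity -/

/-- **Spoke–spoke positivity** (`0 ≤ q ≤ 1`): for rim products `A, B` with weight products `ρ_A, ρ_B`,
`0 ≤ det A·det B + (2−q)·(ρ_Aα_A)(ρ_Bα_B) − det A·α_Bκ_B − det B·α_Aκ_A` — by LEMMA T of the memo this is `F(P,I)F(I,P) − F(P,P)F(I,I) ≥ 0`, i.e.
negative correlation of the two spokes at the ends of the stretches. Three cases on the signs of `κ_A, κ_B`; uses `det ≥ ακ` (monotone covector `𝟙`) and
`κ ≤ ρ`. (transcription of bschramm/prim-bschramm-fk-3/WHEELS-HUB-NC.md §5) -/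
theorem dSS_nonneg {q ρA ρB : ℝ} {A B : Matrix (Fin 2) (Fin 2) ℝ} (hq1 : q ≤ 1) (hA : RimInv q ρA A) (hB : RimInv q ρB B) :
    0 ≤ (A 0 0 * A 1 1 - A 0 1 * A 1 0) * (B 0 0 * B 1 1 - B 0 1 * B 1 0) +
        (2 - q) * (ρA * (A 0 0 + A 1 0)) * (ρB * (B 0 0 + B 1 0)) -
        (A 0 0 * A 1 1 - A 0 1 * A 1 0) * ((B 0 0 + B 1 0) * (B 1 1 - B 1 0)) -
        (B 0 0 * B 1 1 - B 0 1 * B 1 0) * ((A 0 0 + A 1 0) * (A 1 1 - A 1 0)) := by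
  -- abbreviations
  set dA := A 0 0 * A 1 1 - A 0 1 * A 1 0 with hdA
  set dB := B 0 0 * B 1 1 - B 0 1 * B 1 0 with hdB
  set αA := A 0 0 + A 1 0
  set αB := B 0 0 + B 1 0
  set κA := A 1 1 - A 1 0
  set κB := B 1 1 - B 1 0
  have hdA0 : 0 ≤ dA := hA.det_nonneg
  have hdB0 : 0 ≤ dB := hB.det_nonneg
  have hαA : 0 ≤ αA := add_nonneg (hA.nonneg 0 0) (hA.nonneg 1 0)
  have hαB : 0 ≤ αB := add_nonneg (hB.nonneg 0 0) (hB.nonneg 1 0)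
  have hρA := hA.rho_nonneg; have hρB := hB.rho_nonneg
  -- `det ≥ α κ`: `det − ακ = M₁₀ · ((𝟙M)_yes − (𝟙M)_no)`
  have h1A : αA * κA ≤ dA := by
    have hm := hA.mono 1 1 zero_le_one le_rfl
    have : dA - αA * κA = A 1 0 * ((1 * A 0 0 + 1 * A 1 0) - (1 * A 0 1 + 1 * A 1 1)) := by
      simp only [hdA, αA, κA]; ring
    nlinarith [mul_nonneg (hA.nonneg 1 0) (sub_nonneg.2 hm)]
  have h1B : αB * κB ≤ dB := by
    have hm := hB.mono 1 1 zero_le_one le_rfl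
    have : dB - αB * κB = B 1 0 * ((1 * B 0 0 + 1 * B 1 0) - (1 * B 0 1 + 1 * B 1 1)) := by
      simp only [hdB, αB, κB]; ring
    nlinarith [mul_nonneg (hB.nonneg 1 0) (sub_nonneg.2 hm)]
  have hκA : κA ≤ ρA := hA.kappa_le
  have hκB : κB ≤ ρB := hB.kappa_le
  have h2q : 1 ≤ 2 - q := by linarith
  -- three cases on the signs of κA, κB
  by_cases hkA : κA ≤ 0
  · by_cases hkB : κB ≤ 0
    · -- all four terms nonnegative
      have t1 : 0 ≤ -(dA * (αB * κB)) := by nlinarith [mul_nonneg hdA0 (mul_nonneg hαB (neg_nonneg.2 hkB))]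
      have t2 : 0 ≤ -(dB * (αA * κA)) := by nlinarith [mul_nonneg hdB0 (mul_nonneg hαA (neg_nonneg.2 hkA))]
      have t3 : 0 ≤ (2 - q) * (ρA * αA) * (ρB * αB) := by positivity
      nlinarith [mul_nonneg hdA0 hdB0]
    · -- κB > 0 ≥ κA
      push Not at hkB
      have t2 : 0 ≤ -(dB * (αA * κA)) := by nlinarith [mul_nonneg hdB0 (mul_nonneg hαA (neg_nonneg.2 hkA))]
      have t3 : 0 ≤ (2 - q) * (ρA * αA) * (ρB * αB) := by positivity
      nlinarith [mul_nonneg hdA0 (sub_nonneg.2 h1B)]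
  · push Not at hkA
    by_cases hkB : κB ≤ 0
    · have t1 : 0 ≤ -(dA * (αB * κB)) := by nlinarith [mul_nonneg hdA0 (mul_nonneg hαB (neg_nonneg.2 hkB))]
      have t3 : 0 ≤ (2 - q) * (ρA * αA) * (ρB * αB) := by positivity
      nlinarith [mul_nonneg hdB0 (sub_nonneg.2 h1A)]
    · push Not at hkB
      -- D = (dA − αAκA)(dB − αBκB) + [(2−q)ρAαAρBαB − (αAκA)(αBκB)]
      have hx : αA * κA ≤ ρA * αA := by nlinarith [mul_le_mul_of_nonneg_left hκA hαA]
      have hy : αB * κB ≤ ρB * αB := by nlinarith [mul_le_mul_of_nonneg_left hκB hαB]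
      have hx0 : 0 ≤ αA * κA := mul_nonneg hαA hkA.le
      have hy0 : 0 ≤ αB * κB := mul_nonneg hαB hkB.le
      have hprod : (αA * κA) * (αB * κB) ≤ (ρA * αA) * (ρB * αB) := mul_le_mul hx hy hy0 (hx0.trans hx)
      have hcorr : (ρA * αA) * (ρB * αB) ≤ (2 - q) * (ρA * αA) * (ρB * αB) := by
        have h0 : 0 ≤ (ρA * αA) * (ρB * αB) := by positivity
        nlinarith
      nlinarith [mul_nonneg (sub_nonneg.2 h1A) (sub_nonneg.2 h1B)]

/-- **Rim–rim positivity** (`0 ≤ q ≤ 1`): for rim products `A, B` with weight products `ρ_A, ρ_B`,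
`0 ≤ q²·det A·det B + (2−q)·ρ_Aρ_B·λ_Aλ_B − det A·λ_Bμ_B − det B·λ_Aμ_A` (`λ = M₀₁ + qM₁₁`, `μ = qM₀₀ − M₀₁`) — by LEMMA T this is
`F(I,K)F(K,I) − F(I,I)F(K,K) ≥ 0`, negative correlation of the two rim edges at the ends of the stretches.  Uses `q²det − λμ = M₀₁·ψ(M) ≥ 0` (covector `c`) and
`μ ≤ qρ`. (transcription of bschramm/prim-bschramm-fk-3/WHEELS-HUB-NC.md §7) -/
theorem dEE_nonneg {q ρA ρB : ℝ} {A B : Matrix (Fin 2) (Fin 2) ℝ} (hq0 : 0 ≤ q) (hq1 : q ≤ 1) (hA : RimInv q ρA A) (hB : RimInv q ρB B) :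
    0 ≤ q ^ 2 * (A 0 0 * A 1 1 - A 0 1 * A 1 0) * (B 0 0 * B 1 1 - B 0 1 * B 1 0) +
        (2 - q) * (ρA * ρB) * ((A 0 1 + q * A 1 1) * (B 0 1 + q * B 1 1)) -
        (A 0 0 * A 1 1 - A 0 1 * A 1 0) * ((B 0 1 + q * B 1 1) * (q * B 0 0 - B 0 1)) -
        (B 0 0 * B 1 1 - B 0 1 * B 1 0) * ((A 0 1 + q * A 1 1) * (q * A 0 0 - A 0 1)) := by
  set dA := A 0 0 * A 1 1 - A 0 1 * A 1 0 with hdA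
  set dB := B 0 0 * B 1 1 - B 0 1 * B 1 0 with hdB
  set lA := A 0 1 + q * A 1 1
  set lB := B 0 1 + q * B 1 1
  set mA := q * A 0 0 - A 0 1
  set mB := q * B 0 0 - B 0 1
  have hdA0 : 0 ≤ dA := hA.det_nonneg
  have hdB0 : 0 ≤ dB := hB.det_nonneg
  have hlA : 0 ≤ lA := by have := hA.nonneg 0 1; have := hA.nonneg 1 1; positivity
  have hlB : 0 ≤ lB := by have := hB.nonneg 0 1; have := hB.nonneg 1 1; positivity
  have hρA := hA.rho_nonneg; have hρB := hB.rho_nonneg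
  -- `q² det − λ μ = M₀₁ · ψ(M)`, `ψ(M) = (cM)_no − q (cM)_yes ≥ 0`
  have h1A : lA * mA ≤ q ^ 2 * dA := by
    have hψ := hA.monoq 1 q zero_le_one (by rw [mul_one])
    have : q ^ 2 * dA - lA * mA = A 0 1 * ((1 * A 0 1 + q * A 1 1) - q * (1 * A 0 0 + q * A 1 0)) := by
      simp only [hdA, lA, mA]; ring
    nlinarith [mul_nonneg (hA.nonneg 0 1) (sub_nonneg.2 hψ)]
  have h1B : lB * mB ≤ q ^ 2 * dB := by
    have hψ := hB.monoq 1 q zero_le_one (by rw [mul_one])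
    have : q ^ 2 * dB - lB * mB = B 0 1 * ((1 * B 0 1 + q * B 1 1) - q * (1 * B 0 0 + q * B 1 0)) := by
      simp only [hdB, lB, mB]; ring
    nlinarith [mul_nonneg (hB.nonneg 0 1) (sub_nonneg.2 hψ)]
  have hμA : mA ≤ q * ρA := hA.mu_le
  have hμB : mB ≤ q * ρB := hB.mu_le
  have h2q : 1 ≤ 2 - q := by linarith
  by_cases hkA : mA ≤ 0
  · by_cases hkB : mB ≤ 0
    · have t1 : 0 ≤ -(dA * (lB * mB)) := by nlinarith [mul_nonneg hdA0 (mul_nonneg hlB (neg_nonneg.2 hkB))]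
      have t2 : 0 ≤ -(dB * (lA * mA)) := by nlinarith [mul_nonneg hdB0 (mul_nonneg hlA (neg_nonneg.2 hkA))]
      have t3 : 0 ≤ (2 - q) * (ρA * ρB) * (lA * lB) := by positivity
      nlinarith [mul_nonneg (mul_nonneg (sq_nonneg q) hdA0) hdB0]
    · push Not at hkB
      have t2 : 0 ≤ -(dB * (lA * mA)) := by nlinarith [mul_nonneg hdB0 (mul_nonneg hlA (neg_nonneg.2 hkA))]
      have t3 : 0 ≤ (2 - q) * (ρA * ρB) * (lA * lB) := by positivity
      nlinarith [mul_nonneg hdA0 (sub_nonneg.2 h1B)]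
  · push Not at hkA
    by_cases hkB : mB ≤ 0
    · have t1 : 0 ≤ -(dA * (lB * mB)) := by nlinarith [mul_nonneg hdA0 (mul_nonneg hlB (neg_nonneg.2 hkB))]
      have t3 : 0 ≤ (2 - q) * (ρA * ρB) * (lA * lB) := by positivity
      nlinarith [mul_nonneg hdB0 (sub_nonneg.2 h1A)]
    · push Not at hkB
      -- q² D = (q² dA − lA mA)(q² dB − lB mB) + [(2−q) q² ρAρB lA lB − lA mA lB mB], and lA mA lB mB ≤ q² ρA lA ρB lB
      have hx : lA * mA ≤ lA * (q * ρA) := mul_le_mul_of_nonneg_left hμA hlA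
      have hy : lB * mB ≤ lB * (q * ρB) := mul_le_mul_of_nonneg_left hμB hlB
      have hx0 : 0 ≤ lA * mA := mul_nonneg hlA hkA.le
      have hy0 : 0 ≤ lB * mB := mul_nonneg hlB hkB.le
      have hprod : (lA * mA) * (lB * mB) ≤ (lA * (q * ρA)) * (lB * (q * ρB)) := mul_le_mul hx hy hy0 (hx0.trans hx)
      have h0 : 0 ≤ (ρA * ρB) * (lA * lB) := by positivity
      have key : q ^ 2 * (q ^ 2 * dA * dB + (2 - q) * (ρA * ρB) * (lA * lB) - dA * (lB * mB) - dB * (lA * mA)) =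
          (q ^ 2 * dA - lA * mA) * (q ^ 2 * dB - lB * mB) + ((2 - q) * q ^ 2 * ((ρA * ρB) * (lA * lB)) - (lA * mA) * (lB * mB)) := by ring
      have e1 : (lA * (q * ρA)) * (lB * (q * ρB)) = q ^ 2 * ((ρA * ρB) * (lA * lB)) := by ring
      have t2a : (lA * mA) * (lB * mB) ≤ q ^ 2 * ((ρA * ρB) * (lA * lB)) := hprod.trans_eq e1
      have t2b : q ^ 2 * ((ρA * ρB) * (lA * lB)) ≤ (2 - q) * q ^ 2 * ((ρA * ρB) * (lA * lB)) := by
        have hX : 0 ≤ q ^ 2 * ((ρA * ρB) * (lA * lB)) := mul_nonneg (sq_nonneg q) h0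
        have h := mul_nonneg (sub_nonneg.2 h2q) hX
        have e : ((2 - q) - 1) * (q ^ 2 * ((ρA * ρB) * (lA * lB))) =
            (2 - q) * q ^ 2 * ((ρA * ρB) * (lA * lB)) - q ^ 2 * ((ρA * ρB) * (lA * lB)) := by ring
        rw [e] at h
        exact sub_nonneg.1 h
      have hpos : 0 ≤ (q ^ 2 * dA - lA * mA) * (q ^ 2 * dB - lB * mB) +
          ((2 - q) * q ^ 2 * ((ρA * ρB) * (lA * lB)) - (lA * mA) * (lB * mB)) :=
        add_nonneg (mul_nonneg (sub_nonneg.2 h1A) (sub_nonneg.2 h1B)) (sub_nonneg.2 (t2a.trans t2b))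
      -- `μ_A > 0` forces `q > 0` (as `μ_A ≤ q ρ_A`); divide by `q²`
      have hqpos : 0 < q := by
        rcases hq0.lt_or_eq with hlt | heq
        · exact hlt
        · exfalso
          have : mA ≤ 0 := by rw [← heq] at hμA; simpa using hμA
          exact absurd this (not_le.2 hkA)
      have hq2pos : 0 < q ^ 2 := by positivity
      rw [← key] at hpos
      exact (mul_nonneg_iff_of_pos_left hq2pos).1 hpos

/-! ### Trace forms (the shape delivered by LEMMA T) -/

/-- **Hub pairs, trace form**: with `F(P,P) = α_Aα_B`, `F(P,I) = 𝟙ᵀBAe₀`, `F(I,P) = 𝟙ᵀABe₀`, `F(I,I) = Tr(AB) − (2−q)ρ_Aρ_B`: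
`F(P,P)·F(I,I) ≤ F(P,I)·F(I,P)` for rim products `A, B` (`0 ≤ q ≤ 1`). (transcription of bschramm/prim-bschramm-fk-3/WHEELS-HUB-NC.md §3–§5) -/
theorem wheelHub_trace_form {q ρA ρB : ℝ} {A B : Matrix (Fin 2) (Fin 2) ℝ} (hq1 : q ≤ 1) (hA : RimInv q ρA A) (hB : RimInv q ρB B) :
    ((A 0 0 + A 1 0) * (B 0 0 + B 1 0)) * (Matrix.trace (A * B) - (2 - q) * ρA * ρB) ≤
      ((B * A) 0 0 + (B * A) 1 0) * ((A * B) 0 0 + (A * B) 1 0) := by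
  have h := dSS_nonneg hq1 hA hB
  have hid := key_identity_SS (A 0 0) (A 0 1) (A 1 0) (A 1 1) (B 0 0) (B 0 1) (B 1 0) (B 1 1)
  simp only [Matrix.trace, Matrix.diag, Matrix.mul_apply, Fin.sum_univ_two] at *
  nlinarith [h, hid]

/-- **Rim pairs, trace form**: with `F(K,K) = λ_Aλ_B`, `F(I,K) = cᵀABe₁`, `F(K,I) = cᵀBAe₁`, `F(I,I) = Tr(AB) − (2−q)ρ_Aρ_B`:
`F(I,I)·F(K,K) ≤ F(I,K)·F(K,I)` for rim products `A, B` (`0 ≤ q ≤ 1`). (transcription of bschramm/prim-bschramm-fk-3/WHEELS-HUB-NC.md §7) -/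
theorem wheelRim_trace_form {q ρA ρB : ℝ} {A B : Matrix (Fin 2) (Fin 2) ℝ} (hq0 : 0 ≤ q) (hq1 : q ≤ 1) (hA : RimInv q ρA A)
    (hB : RimInv q ρB B) :
    (Matrix.trace (A * B) - (2 - q) * ρA * ρB) * ((A 0 1 + q * A 1 1) * (B 0 1 + q * B 1 1)) ≤
      (((A * B) 0 1 + q * (A * B) 1 1)) * (((B * A) 0 1 + q * (B * A) 1 1)) := by
  have h := dEE_nonneg hq0 hq1 hA hB
  have hid := key_identity_EE q (A 0 0) (A 0 1) (A 1 0) (A 1 1) (B 0 0) (B 0 1) (B 1 0) (B 1 1)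
  simp only [Matrix.trace, Matrix.diag, Matrix.mul_apply, Fin.sum_univ_two] at *
  nlinarith [h, hid]

end WheelTM

end FK

end Summit.CriticalPhenomena.PercolationContinuityZ3.Theorems

end
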